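import Mathlib

set_option linter.dupNamespace false
set_option linter.unusedSectionVars false

/-!
# BlockRankA (lens 4, g29; (P8) inputs of the (c0) road) — RANK FACTORISATION and DISJOINT BLOCKS FROM BIPARTITION CROSS BLOCKS

Blocker `X = AbsorptionDial.NoPerfectPolyOdd` (item 28487); decomp-qadv lens 4, g29.  Two pieces of pure linear algebra around the landed
off-diagonal rank lemma `InnerDegreeLawsK.offDiag_lowRank` ((P8)):

* ★ `exists_factor` (rank factorisation: every matrix `R` is `A * B` through `Fin R.rank` — used to read `uᵀ R u` as `R.rank` products of
  pairs of linear forms, the (P8) ⟹ (P1) step);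
* ★ `blockRank_of_sides` (if for EVERY bipartition `side` the cross block `[side = true, side ≠ true]` of `Q` has rank `≤ r`, then every block
  `Q.submatrix f g` with disjoint injective `f, g` has rank `≤ r` — exactly the hypothesis `hQ` of `offDiag_lowRank`; take `side :=` the indicator
  of `range f` and `Matrix.rank_submatrix_le`).

Supports stmt-QuantumAdvantage-28487 (record; the residual `X` is NOT claimed).
-/

open Finset Module Matrix

namespace Summit.QuantumAdvantage.QuantumAdvantage.Theorems.BlockRank

variable {F : Type*} [Field F] {ι ι' : Type*} [Fintype ι] [Fintype ι'] [DecidableEq ι] [DecidableEq ι']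

/-- **rank factorisation**: `R = A * B` with inner dimension `R.rank`. -/
theorem exists_factor (R : Matrix ι ι' F) :
    ∃ (A : Matrix ι (Fin R.rank) F) (B : Matrix (Fin R.rank) ι' F), R = A * B := by
  classical
  set W : Submodule F (ι' → F) := Submodule.span F (Set.range R.row) with hW
  have hWr : finrank F W = R.rank := by rw [Matrix.rank_eq_finrank_span_row]
  let bW := Module.finBasisOfFinrankEq F W hWr
  have hmem : ∀ i, R i ∈ W := fun i => Submodule.subset_span ⟨i, rfl⟩
  refine ⟨fun i t => bW.repr ⟨R i, hmem i⟩ t, fun t j => (bW t : ι' → F) j, ?_⟩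
  ext i j
  have hx := bW.sum_repr ⟨R i, hmem i⟩
  have hx' := congrArg (fun z : W => (z : ι' → F) j) hx
  simp only [Submodule.coe_sum, Submodule.coe_smul, Finset.sum_apply, Pi.smul_apply, smul_eq_mul] at hx'
  rw [Matrix.mul_apply]
  exact hx'.symm

/-- **disjoint blocks are sub-blocks of bipartition cross blocks.**  If every cross block `[side⁻¹ true, side⁻¹ false]` of `Q` has rank
`≤ r`, then so does every block with disjoint injective row and column maps — the hypothesis `hQ` of `offDiag_lowRank`. -/
theorem blockRank_of_sides (Q : Matrix ι ι F) (r : ℕ)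
    (hside : ∀ side : ι → Bool,
      (Matrix.of fun (i : {i : ι // side i = true}) (j : {j : ι // ¬ side j = true}) => Q i.1 j.1).rank ≤ r)
    (s : ℕ) (f g : Fin s → ι) (hfg : ∀ a b, f a ≠ g b) : (Q.submatrix f g).rank ≤ r := by
  classical
  let side : ι → Bool := fun i => decide (∃ a, f a = i)
  have hf : ∀ a, side (f a) = true := fun a => by
    simp only [side, decide_eq_true_eq]; exact ⟨a, rfl⟩
  have hg : ∀ b, ¬ side (g b) = true := fun b => by
    simp only [side, decide_eq_true_eq, not_exists]
    exact fun a h => hfg a b h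
  let f' : Fin s → {i : ι // side i = true} := fun a => ⟨f a, hf a⟩
  let g' : Fin s → {j : ι // ¬ side j = true} := fun b => ⟨g b, hg b⟩
  have hsub : Q.submatrix f g
      = (Matrix.of fun (i : {i : ι // side i = true}) (j : {j : ι // ¬ side j = true}) => Q i.1 j.1).submatrix f' g' := by
    ext a b
    rfl
  rw [hsub]
  exact (Matrix.rank_submatrix_le _ f' g').trans (hside side)

end Summit.QuantumAdvantage.QuantumAdvantage.Theorems.BlockRank
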